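import Mathlib

/-!
# Tangency sets in `AG(2,p)`: the Illés–Szőnyi–Wettl upper bound in the stub's normalisation

Wall-breaker axis "random-algebraic constructions with certified small instances" for the stub
`stub_tangencySets` of the crux `LevelOneGL2Designs` (item stmt-MatrixMultiplication-14080).

A witness of the stub at a prime `p` is a finite set `S ⊆ 𝔽_p² × 𝔽_p²` with
`x_f ⬝ y_{f'} = 1 ↔ f = f'`: the points `x_f` are pairwise distinct and the line
`ℓ_f = {z | z ⬝ y_f = 1}` meets `X = {x_f}` exactly in `x_f` (a strong representative system of
the affine plane).  We prove the classical counting bound in exactly this vocabulary: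

* `srs_card_sq_le` : `|S|² + 2p² ≤ (p+1)|S| + p³`, i.e. `|S|² − (p+1)|S| ≤ p³ − 2p²`;
* `srs_card_le_rpow` : hence `|S| ≤ p^{3/2} + p`.

So the exponent `3/2` demanded by the stub is extremal up to the constant (`c ≤ 1`
asymptotically), the calibration against which the certified small instances of the companion file
are measured (`|S|_max / p^{3/2}`).

Proof: double count incidences between the `p² − |S|` points `z ∉ X` and the tangent lines.
Every `ℓ_f` carries `p − 1` such points, and two distinct tangent lines share at most one point, so
with `N_z = #{f | z ∈ ℓ_f}` we get `∑ N_z = |S|(p−1)` and `∑ N_z² ≤ |S|(p−1) + |S|(|S|−1)`;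
Cauchy–Schwarz `(∑ N_z)² ≤ (p² − |S|) ∑ N_z²` gives the claim.  [folklore; Illés–Szőnyi–Wettl 1991
for the projective version `|S| ≤ p√p + 1`]
-/

set_option linter.dupNamespace false

namespace Summit.MatrixMultiplication.MatrixMultiplication.Theorems.LevelOneGL2Designs.TangencyRandAlg

open Finset Matrix

variable {p : ℕ} [hp : Fact p.Prime]

/-- An affine line `{z | z ⬝ y = 1}` of `𝔽_p²` (`y ≠ 0`) has exactly `p` points. -/
theorem card_dotProduct_eq_one {y : Fin 2 → ZMod p} (hy : y ≠ 0) :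
    (univ.filter fun z : Fin 2 → ZMod p => dotProduct z y = 1).card = p := by
  classical
  have hy' : y 0 ≠ 0 ∨ y 1 ≠ 0 := by
    by_contra h
    push Not at h
    apply hy
    funext i
    fin_cases i
    · simpa using h.1
    · simpa using h.2
  rcases hy' with h0 | h1
  · have : (univ.filter fun z : Fin 2 → ZMod p => dotProduct z y = 1) =
        univ.image (fun b : ZMod p => ![(1 - b * y 1) / y 0, b]) := by
      ext z
      simp only [mem_filter, mem_univ, true_and, mem_image, dotProduct, Fin.sum_univ_two]
      constructor
      · intro hz
        refine ⟨z 1, ?_⟩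
        funext i
        fin_cases i
        · simp only [Fin.zero_eta, Fin.isValue, cons_val_zero]
          field_simp
          linear_combination -hz
        · simp
      · rintro ⟨b, rfl⟩
        simp only [cons_val_zero, cons_val_one]
        field_simp
        ring
    rw [this, card_image_of_injective, card_univ, ZMod.card]
    intro b b' h
    simpa using congrFun h 1
  · have : (univ.filter fun z : Fin 2 → ZMod p => dotProduct z y = 1) =
        univ.image (fun a : ZMod p => ![a, (1 - a * y 0) / y 1]) := by
      ext z
      simp only [mem_filter, mem_univ, true_and, mem_image, dotProduct, Fin.sum_univ_two]
      constructor
      · intro hz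
        refine ⟨z 0, ?_⟩
        funext i
        fin_cases i
        · simp
        · simp only [Fin.mk_one, Fin.isValue, cons_val_one, cons_val_zero]
          field_simp
          linear_combination -hz
      · rintro ⟨a, rfl⟩
        simp only [cons_val_zero, cons_val_one]
        field_simp
        ring
    rw [this, card_image_of_injective, card_univ, ZMod.card]
    intro a a' h
    simpa using congrFun h 0

/-- Two distinct points `z₁ ≠ z₂` of `𝔽_p²` lying on both lines `{z | z ⬝ y = 1}` and
`{z | z ⬝ y' = 1}` force `y = y'` (two affine lines avoiding the origin that share two points are
equal, and such a line determines its normal functional). -/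
theorem eq_of_two_common_points {y y' z₁ z₂ : Fin 2 → ZMod p}
    (h₁ : dotProduct z₁ y = 1) (h₁' : dotProduct z₁ y' = 1)
    (h₂ : dotProduct z₂ y = 1) (h₂' : dotProduct z₂ y' = 1) (hne : z₁ ≠ z₂) : y = y' := by
  simp only [dotProduct, Fin.sum_univ_two] at h₁ h₁' h₂ h₂'
  -- the cross product of `y` and `y'` vanishes
  have hc0 : (z₁ 0 - z₂ 0) * (y 0 * y' 1 - y 1 * y' 0) = 0 := by
    linear_combination (y' 1) * h₁ - (y' 1) * h₂ - (y 1) * h₁' + (y 1) * h₂'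
  have hc1 : (z₁ 1 - z₂ 1) * (y 0 * y' 1 - y 1 * y' 0) = 0 := by
    linear_combination (-(y' 0)) * h₁ + (y' 0) * h₂ + (y 0) * h₁' - (y 0) * h₂'
  have hc : y 0 * y' 1 - y 1 * y' 0 = 0 := by
    by_contra hc
    apply hne
    funext i
    fin_cases i
    · simpa using sub_eq_zero.mp ((mul_eq_zero.mp hc0).resolve_right hc)
    · simpa using sub_eq_zero.mp ((mul_eq_zero.mp hc1).resolve_right hc)
  funext i
  fin_cases i
  · simp only [Fin.zero_eta, Fin.isValue]
    linear_combination (-(y 0)) * h₁' + (y' 0) * h₁ + (z₁ 1) * hc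
  · simp only [Fin.mk_one, Fin.isValue]
    linear_combination (-(y 1)) * h₁' + (y' 1) * h₁ - (z₁ 0) * hc

/-- **Illés–Szőnyi–Wettl bound, affine dot-product form.**  If `S ⊆ 𝔽_p² × 𝔽_p²` satisfies
`x_f ⬝ y_{f'} = 1 ↔ f = f'` (a witness of `stub_tangencySets` at the prime `p`), then
`|S|² + 2p² ≤ (p + 1)|S| + p³`. [folklore; projective version Illés–Szőnyi–Wettl 1991] -/
theorem srs_card_sq_le (S : Finset ((Fin 2 → ZMod p) × (Fin 2 → ZMod p)))
    (hS : ∀ f ∈ S, ∀ f' ∈ S, (dotProduct f.1 f'.2 = 1 ↔ f = f')) :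
    S.card ^ 2 + 2 * p ^ 2 ≤ (p + 1) * S.card + p ^ 3 := by
  classical
  have hp2 : 2 ≤ p := hp.out.two_le
  -- basic consequences of the design property
  have hdiag : ∀ f ∈ S, dotProduct f.1 f.2 = 1 := fun f hf => (hS f hf f hf).2 rfl
  have hy0 : ∀ f ∈ S, f.2 ≠ 0 := by
    intro f hf h
    have := hdiag f hf
    rw [h, dotProduct_zero] at this
    exact zero_ne_one this
  have hfst : Set.InjOn Prod.fst (S : Set ((Fin 2 → ZMod p) × (Fin 2 → ZMod p))) := by
    intro f hf f' hf' h
    refine (hS f hf f' hf').1 ?_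
    rw [show f.1 = f'.1 from h]
    exact hdiag f' hf'
  have hsnd : ∀ f ∈ S, ∀ f' ∈ S, f.2 = f'.2 → f = f' := by
    intro f hf f' hf' h
    refine (hS f hf f' hf').1 ?_
    rw [← h]
    exact hdiag f hf
  -- the point set `X` and its complement `T`
  set X : Finset (Fin 2 → ZMod p) := S.image Prod.fst with hXdef
  have hXcard : X.card = S.card := card_image_of_injOn hfst
  set T : Finset (Fin 2 → ZMod p) := Xᶜ with hTdef
  have hTcard : T.card + S.card = p ^ 2 := by
    rw [hTdef, ← hXcard, Finset.card_compl_add_card, Fintype.card_fun, ZMod.card, Fintype.card_fin]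
  -- every tangent line carries exactly `p - 1` points outside `X`
  have hrow : ∀ f ∈ S, (T.filter fun z => dotProduct z f.2 = 1).card = p - 1 := by
    intro f hf
    have hL := card_dotProduct_eq_one (hy0 f hf)
    have hmem : f.1 ∈ (univ.filter fun z : Fin 2 → ZMod p => dotProduct z f.2 = 1) := by
      simpa using hdiag f hf
    have : (T.filter fun z => dotProduct z f.2 = 1) =
        (univ.filter fun z : Fin 2 → ZMod p => dotProduct z f.2 = 1).erase f.1 := by
      ext z
      simp only [hTdef, mem_filter, mem_compl, mem_erase, mem_univ, true_and, hXdef, mem_image,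
        not_exists, not_and]
      constructor
      · rintro ⟨hzX, hz⟩
        exact ⟨fun h => hzX f hf h.symm, hz⟩
      · rintro ⟨hz1, hz⟩
        refine ⟨fun g hg hgz => hz1 ?_, hz⟩
        subst hgz
        have : g = f := (hS g hg f hf).1 hz
        rw [this]
    rw [this, card_erase_of_mem hmem, hL]
  -- two distinct tangent lines share at most one point
  have hpair : ∀ f ∈ S, ∀ f' ∈ S, f ≠ f' →
      (T.filter fun z => dotProduct z f.2 = 1 ∧ dotProduct z f'.2 = 1).card ≤ 1 := by
    intro f hf f' hf' hne
    refine card_le_one.mpr fun z₁ hz₁ z₂ hz₂ => ?_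
    by_contra hz
    simp only [mem_filter] at hz₁ hz₂
    exact hne (hsnd f hf f' hf' (eq_of_two_common_points hz₁.2.1 hz₁.2.2 hz₂.2.1 hz₂.2.2 hz))
  -- incidence counts
  set N : (Fin 2 → ZMod p) → ℕ := fun z => (S.filter fun f => dotProduct z f.2 = 1).card with hNdef
  have hsum : ∑ z ∈ T, N z = S.card * (p - 1) := by
    calc ∑ z ∈ T, N z
        = ∑ z ∈ T, ∑ f ∈ S, if dotProduct z f.2 = 1 then 1 else 0 := by
          simp only [hNdef, card_filter]
      _ = ∑ f ∈ S, ∑ z ∈ T, if dotProduct z f.2 = 1 then 1 else 0 := sum_comm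
      _ = ∑ f ∈ S, (T.filter fun z => dotProduct z f.2 = 1).card := by
          simp only [card_filter]
      _ = ∑ f ∈ S, (p - 1) := sum_congr rfl hrow
      _ = S.card * (p - 1) := by rw [sum_const, smul_eq_mul]
  have hsq : ∑ z ∈ T, N z ^ 2 ≤ S.card * ((p - 1) + (S.card - 1)) := by
    have hN2 : ∀ z, N z ^ 2 =
        ∑ f ∈ S, ∑ f' ∈ S, if dotProduct z f.2 = 1 ∧ dotProduct z f'.2 = 1 then 1 else 0 := by
      intro z
      simp only [hNdef]
      rw [card_filter, sq, sum_mul_sum]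
      refine sum_congr rfl fun f _ => sum_congr rfl fun f' _ => ?_
      rw [ite_zero_mul_ite_zero, mul_one]
    calc ∑ z ∈ T, N z ^ 2
        = ∑ z ∈ T, ∑ f ∈ S, ∑ f' ∈ S,
            if dotProduct z f.2 = 1 ∧ dotProduct z f'.2 = 1 then 1 else 0 :=
          sum_congr rfl fun z _ => hN2 z
      _ = ∑ f ∈ S, ∑ f' ∈ S, ∑ z ∈ T,
            if dotProduct z f.2 = 1 ∧ dotProduct z f'.2 = 1 then 1 else 0 := by
          rw [sum_comm]
          exact sum_congr rfl fun f _ => sum_comm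
      _ = ∑ f ∈ S, ∑ f' ∈ S,
            (T.filter fun z => dotProduct z f.2 = 1 ∧ dotProduct z f'.2 = 1).card := by
          simp only [card_filter]
      _ ≤ ∑ f ∈ S, ((p - 1) + (S.card - 1)) := by
          refine sum_le_sum fun f hf => ?_
          rw [← add_sum_erase S _ hf]
          refine add_le_add ?_ ?_
          · simp only [and_self]
            exact (hrow f hf).le
          · calc ∑ f' ∈ S.erase f,
                  (T.filter fun z => dotProduct z f.2 = 1 ∧ dotProduct z f'.2 = 1).card
                ≤ ∑ f' ∈ S.erase f, 1 :=
                  sum_le_sum fun f' hf' =>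
                    hpair f hf f' (mem_of_mem_erase hf') (ne_of_mem_erase hf').symm
              _ = S.card - 1 := by rw [sum_const, smul_eq_mul, mul_one, card_erase_of_mem hf]
      _ = S.card * ((p - 1) + (S.card - 1)) := by rw [sum_const, smul_eq_mul]
  -- Cauchy–Schwarz
  have hCS : (∑ z ∈ T, N z) ^ 2 ≤ T.card * ∑ z ∈ T, N z ^ 2 := sq_sum_le_card_mul_sum_sq
  rw [hsum] at hCS
  have key : (S.card * (p - 1)) ^ 2 ≤ T.card * (S.card * ((p - 1) + (S.card - 1))) :=
    hCS.trans (Nat.mul_le_mul_left _ hsq)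
  -- arithmetic
  rcases Nat.eq_zero_or_pos S.card with hm | hm
  · rw [hm]
    calc 0 ^ 2 + 2 * p ^ 2 = p ^ 2 * 2 := by ring
      _ ≤ p ^ 2 * p := Nat.mul_le_mul_left _ hp2
      _ = (p + 1) * 0 + p ^ 3 := by ring
  · have key' : S.card * (S.card * (p - 1) ^ 2) ≤ S.card * (T.card * ((p - 1) + (S.card - 1))) := by
      calc S.card * (S.card * (p - 1) ^ 2) = (S.card * (p - 1)) ^ 2 := by ring
        _ ≤ T.card * (S.card * ((p - 1) + (S.card - 1))) := key
        _ = S.card * (T.card * ((p - 1) + (S.card - 1))) := by ring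
    have key'' := Nat.le_of_mul_le_mul_left key' hm
    have hT : T.card = p ^ 2 - S.card := by omega
    have hle : S.card ≤ p ^ 2 := by omega
    have hp1 : 1 ≤ p := by omega
    have hm1 : 1 ≤ S.card := hm
    rw [hT] at key''
    zify [hp1, hm1, hle] at key'' ⊢
    nlinarith [key'']

/-- **Corollary (calibration of the exponent `3/2`).**  Every witness of `stub_tangencySets` at the
prime `p` has at most `p^{3/2} + p` flags; in particular the stub asks for objects within a constant
factor of the extremal size (attained, over fields of SQUARE order only, by classical unitals). -/
theorem srs_card_le_rpow (S : Finset ((Fin 2 → ZMod p) × (Fin 2 → ZMod p)))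
    (hS : ∀ f ∈ S, ∀ f' ∈ S, (dotProduct f.1 f'.2 = 1 ↔ f = f')) :
    (S.card : ℝ) ≤ (p : ℝ) ^ (3 / 2 : ℝ) + p := by
  have h := srs_card_sq_le S hS
  have hp1 : (1 : ℝ) ≤ p := by exact_mod_cast hp.out.one_lt.le
  set s : ℝ := Real.sqrt p with hsdef
  have hs1 : 1 ≤ s := by rw [hsdef]; exact Real.one_le_sqrt.mpr hp1
  have hsp : (p : ℝ) = s ^ 2 := by rw [hsdef, Real.sq_sqrt (by linarith)]
  have hpow : (p : ℝ) ^ (3 / 2 : ℝ) = s ^ 3 := by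
    rw [show (3 / 2 : ℝ) = (1 / 2 : ℝ) * 3 by norm_num, Real.rpow_mul (by linarith),
      ← Real.sqrt_eq_rpow, ← hsdef]
    norm_cast
  rw [hpow]
  have hR : (S.card : ℝ) ^ 2 + 2 * (p : ℝ) ^ 2 ≤ (p + 1) * S.card + (p : ℝ) ^ 3 := by
    exact_mod_cast h
  rw [hsp] at hR ⊢
  set m : ℝ := (S.card : ℝ) with hmdef
  by_contra hlt
  push Not at hlt
  -- m > s³ + s² ⇒ m (m - s² - 1) > (s³ + s²)(s³ - 1) ≥ s⁶ - 2 s⁴, contradiction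
  have hm0 : 0 < m - (s ^ 3 + s ^ 2) := by linarith
  have hs0 : 0 ≤ s ^ 3 - 1 := by nlinarith
  nlinarith [mul_pos hm0 (by nlinarith : (0 : ℝ) < m), mul_nonneg hm0.le hs0,
    mul_nonneg (by nlinarith : (0:ℝ) ≤ s ^ 2 * (s - 1)) (zero_le_one.trans hs1)]

end Summit.MatrixMultiplication.MatrixMultiplication.Theorems.LevelOneGL2Designs.TangencyRandAlg
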